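import Literature.Analysis.FluidPDE.KatoLocalBoundedContinuity
import Literature.Analysis.FluidPDE.OseenMildUniqueness
import Literature.Analysis.FluidPDE.TypeIAncientMild
import Literature.Analysis.FluidPDE.NSSerrinRegularityProofs
import Literature.Analysis.FluidPDE.LerayHopfNSRescale
import Literature.Analysis.FluidPDE.LerayHopf
import HarnessLib

/-! # `L⁴` propagation along a DSS Oseen-mild field — crux stmt-NavierStokesRegularity-1404 (`QuantisedSymmetry.PolyhedralDssProfileExists`), line polyhedral_cell, stub stub_dssL4Propagation

Registered stub `stub_dssL4Propagation` (`--supports stmt-NavierStokesRegularity-1404`): a field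
`u` on the past `(−∞, 0) × ℝ³` which is jointly continuous, satisfies the Oseen integral equation
`u(t) = e^{(t−s)Δ}u(s) − B¹ₛ(u,u)(t)` between all pairs `s < t < 0`, obeys the Type-I time rate
`‖u(t,x)‖ ≤ C/√(−t)`, is exactly `c`-DSS (`c > 1`) and has `u(−1) ∈ L⁴(ℝ³)`, lies in
`C((−∞, 0); L⁴)` (`ContinuousInLpOn (Iio 0) 4 u`).

Proof (assembly of proved tree facts; the local step is the `p = 4`, locally-bounded twin of
`Literature.Analysis.FluidPDE.oseenAncient_continuousInLpOn_local`, `OseenAncientKatoClass.lean`).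

* `l4Window` (local step). Below a time `T₁ < 0` the field is bounded by `C/√(−T₁)`. For `s < T₁`
  with `u(s) ∈ L⁴`, Oseen's bounded Picard scheme from the datum `u(s) ∈ L^∞ ∩ L⁴`
  (`exists_oseen_fixedPoint_bounded`, `p = 4`) produces on a window `(0, T)`,
  `T = min δ (T₁ − s)` with `δ = δ(C, T₁) > 0`, a bounded solution of the same integral equation as
  the translate `τ ↦ u(τ + s)` (time covariance of the Duhamel term, `oseenDuhamel_comp_sub_right`),
  so the two agree a.e. slice-wise (`oseenMild_bounded_unique`); this carries the `L⁴` bound to the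
  translate, whose `C([0,T); L⁴)` continuity is `continuousInLpOn_oseen_fixedPoint`; undoing the
  translation, `u ∈ C([s, s + δ) ∩ (−∞, T₁); L⁴)`.
* `memLp_four_of_le` (forward propagation). Real induction (`forall_Icc_of_local_propagation`)
  with the uniform window length: `u(a) ∈ L⁴`, `a ≤ t < 0` ⇒ `u(t) ∈ L⁴`.
* Exact self-similarity `u = nsRescale c⁻¹ u` gives `u(−(c²)ⁿ⁺¹) = nsRescaleData c⁻¹ (u(−(c²)ⁿ))`,
  so all slices `u(−(c²)ⁿ)` are in `L⁴` (`memLp_nsRescaleData`), hence every slice `u(t)`, `t < 0`;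
  continuity at `t₀ < 0` is the local step restarted at `t₀ − δ/2`, whose window is a
  neighbourhood of `t₀`.
-/

noncomputable section

-- the summit namespace `…NavierStokesRegularity.NavierStokesRegularity…` is the tree convention (D-0017)
set_option linter.dupNamespace false

namespace Summit.NavierStokesRegularity.NavierStokesRegularity.Theorems.PolyhedralDssProfileExists.PolyhedralCell

open MeasureTheory Set Function Filter Topology
open scoped ENNReal NNReal
open Literature.Analysis.FluidPDE

/-! ### Two transport helpers -/

/-- `C(S; Lᵖ)` is transported along a time translation: if `v ∈ C(S; Lᵖ)`, `t ↦ t - s` maps `S'`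
into `S` and `u(t) = v(t - s)` for `t ∈ S'`, then `u ∈ C(S'; Lᵖ)`. -/
theorem continuousInLpOn_of_shift {X : Type*} [MeasureSpace X] {F : Type*} [NormedAddCommGroup F]
    {S S' : Set ℝ} {p : ℝ≥0∞} {u v : ℝ → X → F} (s : ℝ) (hv : ContinuousInLpOn S p v)
    (hmaps : MapsTo (fun t => t - s) S' S) (heq : ∀ t ∈ S', u t = v (t - s)) :
    ContinuousInLpOn S' p u := by
  refine ⟨fun t ht => by rw [heq t ht]; exact hv.1 (t - s) (hmaps ht), fun t₀ ht₀ => ?_⟩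
  have hmap : Tendsto (fun t => t - s) (𝓝[S'] t₀) (𝓝[S] (t₀ - s)) :=
    (continuous_id.sub continuous_const).continuousWithinAt.tendsto_nhdsWithin hmaps
  refine ((hv.2 (t₀ - s) (hmaps ht₀)).comp hmap).congr' ?_
  filter_upwards [self_mem_nhdsWithin] with t ht
  simp only [Function.comp_apply]
  rw [heq t ht, heq t₀ ht₀]

/-- Time covariance of the Duhamel term under a forward translation:
`B^ν_{s₀}(u(· + δ), v(· + δ))(t) = B^ν_{s₀+δ}(u, v)(t + δ)` (`oseenDuhamel_comp_sub_right` with `-δ`). -/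
theorem oseenDuhamel_comp_add_right (ν s₀ t δ : ℝ)
    (u v : ℝ → EuclideanSpace ℝ (Fin 3) → EuclideanSpace ℝ (Fin 3)) (x : EuclideanSpace ℝ (Fin 3)) :
    oseenDuhamel ν s₀ (fun τ => u (τ + δ)) (fun τ => v (τ + δ)) t x =
      oseenDuhamel ν (s₀ + δ) u v (t + δ) x := by
  simpa only [sub_neg_eq_add] using oseenDuhamel_comp_sub_right ν s₀ t (-δ) u v x

/-! ### The local step: Oseen's bounded Picard scheme and uniqueness -/

/-- **Local `L⁴` window.** Let `u` be jointly continuous on `(−∞, 0) × ℝ³`, Oseen-mild between all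
pairs `s < t < 0`, with the Type-I rate `‖u(t,x)‖ ≤ C/√(−t)`. For every `T₁ < 0` there is `δ > 0`
such that for every `s < T₁` with `u(s) ∈ L⁴`, `u ∈ C([s, s + δ) ∩ (−∞, T₁); L⁴)`. (Adapted from
`oseenAncient_continuousInLpOn_local`: Picard scheme `exists_oseen_fixedPoint_bounded` at `p = 4`
from the datum `u(s)`, bounded by `max (C/√(−T₁)) 1`; uniqueness `oseenMild_bounded_unique`
identifies it with `τ ↦ u(τ + s)`; continuity `continuousInLpOn_oseen_fixedPoint`.) -/
theorem l4Window {u : ℝ → EuclideanSpace ℝ (Fin 3) → EuclideanSpace ℝ (Fin 3)} {C : ℝ}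
    (hcont : ContinuousOn (Function.uncurry u) (Set.Iio 0 ×ˢ Set.univ))
    (hmild : ∀ s t : ℝ, s < t → t < 0 → ∀ x,
      u t x = heatFlow (u s) (t - s) x - oseenDuhamel 1 s u u t x)
    (hI : HasTypeITimeDecay C u) {T₁ : ℝ} (hT₁ : T₁ < 0) :
    ∃ δ > 0, ∀ s < T₁, MemLp (u s) 4 volume →
      ContinuousInLpOn (Ico s (s + δ) ∩ Iio T₁) 4 u := by
  -- `0 ≤ C`, from the rate at `t = -1`
  have hC : 0 ≤ C := by
    have h := hI (-1) (by norm_num) 0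
    rw [neg_neg, Real.sqrt_one, div_one] at h
    exact (norm_nonneg _).trans h
  -- the uniform bound below `T₁`
  have hbd : ∀ t ≤ T₁, ∀ x, ‖u t x‖ ≤ C / Real.sqrt (-T₁) := fun t ht x =>
    (hI t (by linarith) x).trans (div_le_div_of_nonneg_left hC (Real.sqrt_pos.2 (by linarith))
      (Real.sqrt_le_sqrt (by linarith)))
  obtain ⟨K, hK, hscheme⟩ :=
    exists_oseen_fixedPoint_bounded (E := EuclideanSpace ℝ (Fin 3)) (p := 4) (by norm_num)
      (by norm_num)
  -- the bound `A = max (C/√(-T₁)) 1 > 0` and the lifespan `δ = ((16 K)⁻¹ / A)²`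
  set A : ℝ := max (C / Real.sqrt (-T₁)) 1 with hA_def
  have hA : 0 < A := lt_max_of_lt_right one_pos
  have hMA : C / Real.sqrt (-T₁) ≤ A := le_max_left _ _
  have hA2 : (0 : ℝ) ≤ 2 * A := by positivity
  set δ : ℝ := ((16 * K)⁻¹ / A) ^ 2 with hδ_def
  have hδ : 0 < δ := by positivity
  refine ⟨δ, hδ, fun s hs hs4 => ?_⟩
  have hs0 : s < 0 := hs.trans hT₁
  -- the window `(0, T)` in the translated frame, `T = min δ (T₁ - s)`
  set T : ℝ := min δ (T₁ - s) with hT_def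
  have hT : 0 < T := lt_min hδ (sub_pos.2 hs)
  have hTδ : T ≤ δ := min_le_left _ _
  have hTs : T ≤ T₁ - s := min_le_right _ _
  have hsmall : K * A * (1 : ℝ) ^ (-(1 / 2 : ℝ)) * (2 * Real.sqrt T) ≤ 1 / 8 := by
    rw [Real.one_rpow, mul_one]
    have h1 : Real.sqrt T ≤ (16 * K)⁻¹ / A := by
      rw [Real.sqrt_le_left (by positivity)]
      exact hTδ
    calc K * A * (2 * Real.sqrt T) ≤ K * A * (2 * ((16 * K)⁻¹ / A)) := by gcongr
      _ = 1 / 8 := by field_simp; norm_num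
  -- the datum `u s`: measurable, bounded by `A`, in `L⁴`
  have ham : AEStronglyMeasurable (u s) volume := hs4.1
  have habd : ∀ x, ‖u s x‖ ≤ A := fun x => (hbd s hs.le x).trans hMA
  -- Oseen's scheme from `u s`
  obtain ⟨w, hwm, hwbd, hw4, hwsl, hwfix⟩ := hscheme one_pos hT hA ham habd hs4 hsmall
  -- the translate `v τ = u (τ + s)` solves the same integral equation on `(0, T)`
  set v : ℝ → EuclideanSpace ℝ (Fin 3) → EuclideanSpace ℝ (Fin 3) := fun τ => u (τ + s) with hv_def
  have hv_apply : ∀ τ x, v τ x = u (τ + s) x := fun τ x => rfl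
  have hvwin : ∀ τ ∈ Ioo 0 T, τ + s ≤ T₁ := fun τ hτ => by linarith [hτ.2]
  have hvbd : ∀ τ ∈ Ioo 0 T, ∀ x, ‖v τ x‖ ≤ 2 * A := fun τ hτ x => by
    rw [hv_apply]
    exact ((hbd _ (hvwin τ hτ) x).trans hMA).trans (by linarith)
  have hvbd' : ∀ τ ∈ Ioo 0 T, ∀ x, ‖v τ x‖ ≤ C / Real.sqrt (-T₁) := fun τ hτ x =>
    hbd _ (hvwin τ hτ) x
  have hvfix : ∀ τ ∈ Ioo 0 T, ∀ x,
      v τ x = Literature.Analysis.UnboundedOperators.heatExtension (u s) (1 * τ) x -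
        oseenDuhamel 1 0 v v τ x := by
    intro τ hτ x
    have h := hmild s (τ + s) (by linarith [hτ.1]) (by linarith [hvwin τ hτ]) x
    rw [add_sub_cancel_right, heatFlow_of_pos _ hτ.1] at h
    have hB : oseenDuhamel 1 0 v v τ x = oseenDuhamel 1 s u u (τ + s) x := by
      rw [hv_def, oseenDuhamel_comp_add_right, zero_add]
    rw [hB, one_mul, hv_apply]
    exact h
  -- measurability of the translate on the slab and of its slices (continuity)
  have hvcont : ContinuousOn (uncurry v) (Ioo 0 T ×ˢ (univ : Set (EuclideanSpace ℝ (Fin 3)))) := by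
    have e : uncurry v = uncurry u ∘ fun z : ℝ × EuclideanSpace ℝ (Fin 3) => (z.1 + s, z.2) := by
      funext ⟨τ, x⟩; rfl
    rw [e]
    refine hcont.comp (by fun_prop) fun z hz => ⟨?_, mem_univ _⟩
    show z.1 + s < 0
    linarith [hvwin z.1 hz.1]
  have hvm : AEStronglyMeasurable (uncurry v)
      ((volume : Measure (ℝ × EuclideanSpace ℝ (Fin 3))).restrict (Ioo 0 T ×ˢ univ)) :=
    hvcont.aestronglyMeasurable (measurableSet_Ioo.prod MeasurableSet.univ)
  have hvsl : ∀ τ ∈ Ioo 0 T, AEStronglyMeasurable (v τ) volume := fun τ hτ =>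
    (hcont.comp_continuous (f := fun x : EuclideanSpace ℝ (Fin 3) => (τ + s, x)) (by fun_prop)
      fun _ => ⟨show τ + s < 0 by linarith [hvwin τ hτ], mem_univ _⟩).aestronglyMeasurable
  -- uniqueness of bounded solutions of the integral equation
  have hae : ∀ τ ∈ Ioo 0 T, w τ =ᵐ[volume] v τ :=
    oseenMild_bounded_unique
      (U := fun τ x => Literature.Analysis.UnboundedOperators.heatExtension (u s) (1 * τ) x)
      one_pos hA2 hwm hvm hwbd hvbd (fun τ hτ => Eventually.of_forall (hwfix τ hτ))
      (fun τ hτ => Eventually.of_forall (hvfix τ hτ))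
  -- the `L⁴` bound carried to the translate, and its continuity in `L⁴` on `[0, T)`
  have hL : ∀ τ ∈ Ioo 0 T,
      eLpNorm (v τ) 4 volume ≤ ((2 * eLpNorm (u s) 4 volume).toNNReal : ℝ≥0∞) := by
    intro τ hτ
    rw [ENNReal.coe_toNNReal (ENNReal.mul_ne_top ENNReal.ofNat_ne_top hs4.eLpNorm_ne_top),
      ← eLpNorm_congr_ae (hae τ hτ)]
    exact hw4 τ hτ
  have hcontv := continuousInLpOn_oseen_fixedPoint (E := EuclideanSpace ℝ (Fin 3)) (p := 4)
    (by norm_num) (by norm_num) one_pos ham habd hs4 hvm (div_nonneg hC (Real.sqrt_nonneg _))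
    hvbd' hL hvsl hvfix
  -- back to `u` along `t ↦ t - s`
  refine continuousInLpOn_of_shift s hcontv (fun t ht => ?_) (fun t ht => ?_)
  · have htT : t < T₁ := ht.2
    exact ⟨by linarith [ht.1.1], lt_min (by linarith [ht.1.2]) (by linarith)⟩
  · funext x
    show u t x = if 0 < t - s then v (t - s) x else u s x
    rcases ht.1.1.eq_or_lt with h | h
    · rw [← h, sub_self, if_neg (lt_irrefl 0)]
    · rw [if_pos (sub_pos.2 h), hv_apply, sub_add_cancel]

/-! ### Forward propagation of the `L⁴` slices -/

/-- **Forward propagation.** Under the hypotheses of `l4Window`, if `u(a) ∈ L⁴` then `u(t) ∈ L⁴`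
for every `t ∈ [a, 0)`: real induction over `[a, t]` (`forall_Icc_of_local_propagation`) with the
window of `l4Window` at `T₁ = t/2`, whose length is uniform on `[a, t]`. -/
theorem memLp_four_of_le {u : ℝ → EuclideanSpace ℝ (Fin 3) → EuclideanSpace ℝ (Fin 3)} {C : ℝ}
    (hcont : ContinuousOn (Function.uncurry u) (Set.Iio 0 ×ˢ Set.univ))
    (hmild : ∀ s t : ℝ, s < t → t < 0 → ∀ x,
      u t x = heatFlow (u s) (t - s) x - oseenDuhamel 1 s u u t x)
    (hI : HasTypeITimeDecay C u) {a : ℝ} (ha4 : MemLp (u a) 4 volume) {t : ℝ} (hat : a ≤ t)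
    (ht : t < 0) : MemLp (u t) 4 volume := by
  obtain ⟨δ, hδ, hwin⟩ := l4Window hcont hmild hI (T₁ := t / 2) (by linarith)
  refine forall_Icc_of_local_propagation (P := fun τ => MemLp (u τ) 4 volume) ha4
    (fun σ _ => ⟨δ / 2, by positivity, fun τ₁ hτ₁ τ₂ hτ₂ h1 h12 h2 hP => ?_⟩) t ⟨hat, le_rfl⟩
  exact (hwin τ₁ (by linarith [hτ₁.2]) hP).1 τ₂
    ⟨⟨h12, by linarith⟩, show τ₂ < t / 2 by linarith [hτ₂.2]⟩

/-! ### The stub -/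

/-- **Stub `stub_dssL4Propagation` (`L⁴` propagation along a DSS Oseen-mild field).** A field `u`
on the past which is jointly continuous on `(-∞, 0) × ℝ³`, satisfies the Oseen integral equation
between all pairs `s < t < 0`, obeys a Type-I time rate `‖u(t,x)‖ ≤ C/√(-t)`, is exactly `c`-DSS
(`c > 1`) and has `u(-1) ∈ L⁴(ℝ³)`, has every slice `u(t)`, `t < 0`, in `L⁴` and is
`L⁴`-continuous on `(-∞, 0)`. The slices `u(−(c²)ⁿ) = nsRescaleData c⁻¹ (u(−(c²)ⁿ⁻¹))` are in
`L⁴` by exact self-similarity (`memLp_nsRescaleData`), every `t < 0` lies above one of them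
(`memLp_four_of_le`), and continuity at `t₀ < 0` is the window of `l4Window` started at
`t₀ − δ/2`, a neighbourhood of `t₀`. -/
theorem stub_dssL4Propagation :
    ∀ (c : ℝ), 1 < c → ∀ (u : ℝ → EuclideanSpace ℝ (Fin 3) → EuclideanSpace ℝ (Fin 3)) (C : ℝ),
      ContinuousOn (Function.uncurry u) (Set.Iio 0 ×ˢ Set.univ) →
      (∀ s t : ℝ, s < t → t < 0 → ∀ x,
        u t x = heatFlow (u s) (t - s) x - oseenDuhamel 1 s u u t x) →
      HasTypeITimeDecay C u → IsDiscretelySelfSimilar c u → MemLp (u (-1)) 4 volume →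
      ContinuousInLpOn (Set.Iio 0) 4 u := by
  intro c hc u C hcont hmild hI hdss h4
  have hcne : c ≠ 0 := (zero_lt_one.trans hc).ne'
  -- exact self-similarity with the inverse factor
  have hinv : nsRescale c⁻¹ u = u := by
    have h := nsRescale_inv_nsRescale hcne u
    have hdss' : nsRescale c u = u := hdss
    rwa [hdss'] at h
  have hslice : ∀ t, u t = nsRescaleData c⁻¹ (u (c⁻¹ ^ 2 * t)) := fun t => by
    funext x
    rw [nsRescaleData_apply, ← nsRescale_apply c⁻¹ u t x, hinv]
  -- the slices at the times `-(c²)ⁿ` are in `L⁴`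
  have hpow : ∀ n : ℕ, MemLp (u (-((c ^ 2) ^ n))) 4 volume := by
    intro n
    induction n with
    | zero => simpa using h4
    | succ n ih =>
      rw [hslice]
      have e : c⁻¹ ^ 2 * -((c ^ 2) ^ (n + 1)) = -((c ^ 2) ^ n) := by
        rw [pow_succ (c ^ 2) n]
        field_simp
      rw [e]
      exact memLp_nsRescaleData ih (inv_ne_zero hcne)
  -- hence every slice is in `L⁴`
  have hc2 : 1 < c ^ 2 := by nlinarith
  have hL4 : ∀ t < 0, MemLp (u t) 4 volume := fun t ht => by
    obtain ⟨n, hn⟩ := pow_unbounded_of_one_lt (-t) hc2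
    exact memLp_four_of_le hcont hmild hI (hpow n) (by linarith) ht
  refine ⟨fun t ht => hL4 t ht, fun t₀ ht₀ => ?_⟩
  have ht₀' : t₀ < 0 := ht₀
  -- continuity at `t₀`: the window started at `t₀ - δ/2` is a neighbourhood of `t₀`
  obtain ⟨δ, hδ, hwin⟩ := l4Window hcont hmild hI (T₁ := t₀ / 2) (by linarith)
  have hW := hwin (t₀ - δ / 2) (by linarith) (hL4 _ (by linarith))
  have hmem : Ico (t₀ - δ / 2) (t₀ - δ / 2 + δ) ∩ Iio (t₀ / 2) ∈ 𝓝 t₀ :=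
    inter_mem (mem_of_superset (Ioo_mem_nhds (by linarith) (by linarith)) Ioo_subset_Ico_self)
      (Iio_mem_nhds (by linarith))
  have h := hW.2 t₀ (mem_of_mem_nhds hmem)
  rw [nhdsWithin_eq_nhds.2 hmem] at h
  exact h.mono_left nhdsWithin_le_nhds

end Summit.NavierStokesRegularity.NavierStokesRegularity.Theorems.PolyhedralDssProfileExists.PolyhedralCell
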